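import Summits.ResolutionOfSingularities.ResolutionOfSingularities.Theorems.WildTwistedToricLU7
import HarnessLib

/-!
# WildCocycleLU (1/4) — COCYCLE ALGEBRA of a log-diagonal frame

Node «CocycleCut» (decomp-res lens-1 g34), tree file 1/4: the GRADING of the mixed-unit log-diagonal kind
`λ″ = WildLogDiagonalLU.WildLogDiagonalMixedAbove` by the RANK of its frame cocycles.

For a `ℤ/p`-action `σ` on the regular local ring `B` upstairs and a log-diagonal frame `σ x′_j = x′_j · u_j`
(`u_j` units of `B`), the classes `[u_j] ∈ H¹(⟨σ⟩, B^×) = {norm-one units}/{σφ/φ}` span an `F_p`-vector space;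
its dimension `r` is the GRADE.  This file is the pure algebra of that grading, over an arbitrary subring `B` of a
field `E` with an automorphism `σ`:
* `IsUnitCoboundary B σ z` (`z = σφ/φ`, `φ` a unit of `B`) and its group closure;
* TELESCOPING NORM `∏_{i<n} σⁱ(σy/y) = σⁿy/y`, so every frame cocycle `u_j = σx′_j/x′_j` has NORM ONE when `σ^p = 1`;
* `H¹` IS `p`-TORSION: a norm-one unit has `u^p = σΦ/Φ` for the Hilbert-90 unit `Φ = ∏(σⁱu)ⁱ` of
  `WildTwistedToricLU.apply_twistUnit` (landed, g33);
* BEZOUT mod `p` and THE CYCLIC PRESENTATION: if `u_{j₁}` is not a unit coboundary and every pair `(j₁, j)` is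
  `F_p`-DEPENDENT (`u_{j₁}^a u_j^b = σφ/φ` with `p ∤ a` or `p ∤ b`), then `u_j ≡ u_{j₁}^{N_j}` modulo unit
  coboundaries for all `j` — grade `1`;
* PRINCIPAL UNITS FROM NORM ONE: a norm-one unit with residue in the (fixed) constants is `≡ 1 (mod 𝔪′)`
  (Frobenius: `c^p = 1 ⇒ c = 1`);
* GRADE `0` IS EMPTY (Nakayama): if `σ` fixes a generating system of the centre of `B = T_𝔪′` and residues are
  fixed constants, then `σ = id` on `B`.
Files 2–4: the kinds `λ₁` (grade 1) / `λ₂` (grade ≥ 2), THE LAW on `λ₁`, the EXACT CARVE `λ″ ↔ λ₁ ∨ λ₂`, toys,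
the located residual `R35`, the cut and the root by name.
[folklore (group cohomology of cyclic groups, Hilbert Satz 90); cite: KiralyLutkebohmert2013, Thm. 2, Rem. 3;
cite: Peskin1983, Thm. 3.8]
-/

noncomputable section

open IsLocalRing Literature.AlgebraicGeometry.Resolution
open Summit.ResolutionOfSingularities.ResolutionOfSingularities.Theorems.InvariantDescentLU
open Summit.ResolutionOfSingularities.ResolutionOfSingularities.Theorems.WildReflectionLU
open Summit.ResolutionOfSingularities.ResolutionOfSingularities.Theorems.WildTwistedToricLU

universe u

namespace Summit.ResolutionOfSingularities.ResolutionOfSingularities.Theorems.WildCocycleLU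

variable {E : Type u} [Field E]

/-- **UNIT COBOUNDARY.** `z = σ φ / φ` for a unit `φ` of the subring `B` (`φ ≠ 0`, `φ, φ⁻¹ ∈ B`): the trivial
class of `H¹(⟨σ⟩, B^×)`. [folklore] -/
def IsUnitCoboundary (B : Subring E) (σ : E ≃+* E) (z : E) : Prop :=
  ∃ φ : E, φ ≠ 0 ∧ φ ∈ B ∧ φ⁻¹ ∈ B ∧ z = σ φ / φ

section Coboundary

variable {B : Subring E} {σ : E ≃+* E}

/-- `1 = σ1/1`. [folklore] -/
theorem isUnitCoboundary_one : IsUnitCoboundary B σ 1 :=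
  ⟨1, one_ne_zero, B.one_mem, by rw [inv_one]; exact B.one_mem, by rw [map_one, div_one]⟩

/-- Unit coboundaries are closed under products. [folklore] -/
theorem IsUnitCoboundary.mul {z z' : E} (hz : IsUnitCoboundary B σ z) (hz' : IsUnitCoboundary B σ z') :
    IsUnitCoboundary B σ (z * z') := by
  obtain ⟨φ, hφ0, hφ, hφi, rfl⟩ := hz
  obtain ⟨ψ, hψ0, hψ, hψi, rfl⟩ := hz'
  refine ⟨φ * ψ, mul_ne_zero hφ0 hψ0, B.mul_mem hφ hψ, by rw [mul_inv]; exact B.mul_mem hφi hψi, ?_⟩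
  rw [map_mul, mul_div_mul_comm]

/-- … and inverses. [folklore] -/
theorem IsUnitCoboundary.inv {z : E} (hz : IsUnitCoboundary B σ z) : IsUnitCoboundary B σ z⁻¹ := by
  obtain ⟨φ, hφ0, hφ, hφi, rfl⟩ := hz
  refine ⟨φ⁻¹, inv_ne_zero hφ0, hφi, by rw [inv_inv]; exact hφ, ?_⟩
  rw [map_inv₀, inv_div, div_inv_eq_mul, inv_mul_eq_div]

/-- … and natural powers. [folklore] -/
theorem IsUnitCoboundary.pow {z : E} (hz : IsUnitCoboundary B σ z) (n : ℕ) : IsUnitCoboundary B σ (z ^ n) := by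
  induction n with
  | zero => rw [pow_zero]; exact isUnitCoboundary_one
  | succ n ih => rw [pow_succ]; exact ih.mul hz

/-- … and integer powers. [folklore] -/
theorem IsUnitCoboundary.zpow {z : E} (hz : IsUnitCoboundary B σ z) (n : ℤ) : IsUnitCoboundary B σ (z ^ n) := by
  obtain ⟨m, rfl | rfl⟩ := n.eq_nat_or_neg
  · rw [zpow_natCast]; exact hz.pow m
  · rw [zpow_neg, zpow_natCast]; exact (hz.pow m).inv

/-- A unit coboundary is non-zero. [folklore] -/
theorem IsUnitCoboundary.ne_zero {z : E} (hz : IsUnitCoboundary B σ z) : z ≠ 0 := by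
  obtain ⟨φ, hφ0, -, -, rfl⟩ := hz
  exact div_ne_zero ((map_ne_zero_iff (σ : E ≃+* E) σ.injective).mpr hφ0) hφ0

/-- A unit coboundary for `σ` on `B` is a unit of `B` when `σ` preserves `B`. [folklore] -/
theorem IsUnitCoboundary.mem (hσB : ∀ z ∈ B, σ z ∈ B) {z : E} (hz : IsUnitCoboundary B σ z) :
    z ∈ B ∧ z⁻¹ ∈ B := by
  obtain ⟨φ, hφ0, hφ, hφi, rfl⟩ := hz
  refine ⟨?_, ?_⟩
  · rw [div_eq_mul_inv]; exact B.mul_mem (hσB φ hφ) hφi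
  · rw [inv_div, div_eq_mul_inv, ← map_inv₀]; exact B.mul_mem hφ (hσB _ hφi)

end Coboundary

/-! ## Norm of a logarithmic derivative; `H¹` is `p`-torsion -/
section Norm

variable {B : Subring E} {σ : E ≃+* E}

/-- `σⁱ` preserves `B` when `σ` does. [folklore] -/
theorem pow_apply_mem (hσB : ∀ z ∈ B, σ z ∈ B) (i : ℕ) {z : E} (hz : z ∈ B) : (σ ^ i) z ∈ B := by
  induction i with
  | zero => rwa [pow_zero, RingAut.one_apply]
  | succ i ih => rw [pow_succ', RingAut.mul_apply]; exact hσB _ ih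

/-- TELESCOPING NORM: `∏_{i<n} σⁱ (σ y / y) = σⁿ y / y`. [folklore] -/
theorem prod_range_pow_apply_div (σ : E ≃+* E) {y : E} (hy : y ≠ 0) (n : ℕ) :
    ∏ i ∈ Finset.range n, (σ ^ i) (σ y / y) = (σ ^ n) y / y := by
  induction n with
  | zero => rw [Finset.prod_range_zero, pow_zero, RingAut.one_apply, div_self hy]
  | succ n ih =>
    have hA : (σ ^ n) y ≠ 0 := (map_ne_zero_iff _ (σ ^ n).injective).mpr hy
    rw [Finset.prod_range_succ, ih, map_div₀, ← RingAut.mul_apply, ← pow_succ, div_mul_div_comm,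
      mul_comm ((σ ^ n) y) ((σ ^ (n + 1)) y), mul_div_mul_right _ _ hA]

/-- **NORM ONE OF A FRAME COCYCLE**: for `σ^p = 1` and `y ≠ 0`, `∏_{i<p} σⁱ (σ y / y) = 1` — every unit
`u_j = σ x′_j / x′_j` of a log-diagonal frame has norm one AUTOMATICALLY. [folklore] -/
theorem norm_apply_div_eq_one {p : ℕ} (hσp : σ ^ p = 1) {y : E} (hy : y ≠ 0) :
    ∏ i ∈ Finset.range p, (σ ^ i) (σ y / y) = 1 := by
  rw [prod_range_pow_apply_div σ hy, hσp, RingAut.one_apply, div_self hy]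

/-- **`H¹(⟨σ⟩, B^×)` IS `p`-TORSION**: a unit `u` of `B` of norm one has `u^p = σΦ/Φ` for the Hilbert-90 unit
`Φ = ∏_{i<p} (σⁱu)ⁱ` (landed `WildTwistedToricLU.apply_twistUnit`), a unit of `B`. [folklore (Hilbert 90);
cite: Peskin1983, Thm. 3.8] -/
theorem isUnitCoboundary_pow_of_norm_eq_one (hσB : ∀ z ∈ B, σ z ∈ B) {p : ℕ} (hσp : σ ^ p = 1) {u : E}
    (hu0 : u ≠ 0) (hu : u ∈ B) (hui : u⁻¹ ∈ B) (hnorm : ∏ i ∈ Finset.range p, (σ ^ i) u = 1) :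
    IsUnitCoboundary B σ (u ^ p) := by
  have hΦ0 : (∏ i ∈ Finset.range p, ((σ ^ i) u) ^ i) ≠ 0 :=
    Finset.prod_ne_zero_iff.mpr fun i _ => pow_ne_zero _ ((map_ne_zero_iff _ (σ ^ i).injective).mpr hu0)
  have hΦB : (∏ i ∈ Finset.range p, ((σ ^ i) u) ^ i) ∈ B :=
    B.prod_mem fun i _ => B.pow_mem (pow_apply_mem hσB i hu) i
  have hΦi : (∏ i ∈ Finset.range p, ((σ ^ i) u) ^ i)⁻¹ ∈ B := by
    rw [← Finset.prod_inv_distrib]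
    exact B.prod_mem fun i _ => by
      rw [← inv_pow, ← map_inv₀]; exact B.pow_mem (pow_apply_mem hσB i hui) i
  refine ⟨∏ i ∈ Finset.range p, ((σ ^ i) u) ^ i, hΦ0, hΦB, hΦi, ?_⟩
  rw [apply_twistUnit hσp hu0 hnorm, mul_div_cancel_left₀ _ hΦ0]

/-- BEZOUT mod `p`: if `u^p` and `u^a` with `p ∤ a` are unit coboundaries, so is `u`. [folklore] -/
theorem isUnitCoboundary_of_zpow {p : ℕ} (hp : p.Prime) {u : E} (hu0 : u ≠ 0)
    (hup : IsUnitCoboundary B σ (u ^ p)) {a : ℤ} (ha : ¬ (p : ℤ) ∣ a) (hua : IsUnitCoboundary B σ (u ^ a)) :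
    IsUnitCoboundary B σ u := by
  obtain ⟨s, t, hst⟩ := (Prime.coprime_iff_not_dvd (Nat.prime_iff_prime_int.mp hp)).mpr ha
  have hupz : IsUnitCoboundary B σ (u ^ (p : ℤ)) := by rw [zpow_natCast]; exact hup
  have e : (u ^ (p : ℤ)) ^ s * (u ^ a) ^ t = u := by
    rw [← zpow_mul, ← zpow_mul, ← zpow_add₀ hu0, show (p : ℤ) * s + a * t = 1 by linarith, zpow_one]
  rw [← e]
  exact (hupz.zpow s).mul (hua.zpow t)

/-- **THE CYCLIC PRESENTATION (grade 1).**  Units `u_j` of `B` (`u_j ≠ 0`) with `u_j^p` unit coboundaries, a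
distinguished `u_{j₁}` that is NOT a unit coboundary, and every pair `(j₁, j)` `F_p`-DEPENDENT: then for every
`j` there is `N_j ∈ ℤ` with `u_{j₁}^{N_j} / u_j` a unit coboundary — all classes lie on the line `F_p·[u_{j₁}]`.
(Dependent with `p ∣ b` would force `p ∤ a` and `[u_{j₁}] = 0` by Bezout; so `p ∤ b`, and Bezout for `b`
solves for `[u_j]`.) [folklore] -/
theorem exists_zpow_div_isUnitCoboundary {p : ℕ} (hp : p.Prime) {d : ℕ} {u : Fin d → E}
    (hu0 : ∀ j, u j ≠ 0) (hup : ∀ j, IsUnitCoboundary B σ (u j ^ p)) {j₁ : Fin d}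
    (hj₁ : ¬ IsUnitCoboundary B σ (u j₁))
    (hdep : ∀ j, ∃ a b : ℤ, ¬ ((p : ℤ) ∣ a ∧ (p : ℤ) ∣ b) ∧ IsUnitCoboundary B σ (u j₁ ^ a * u j ^ b)) :
    ∃ N : Fin d → ℤ, ∀ j, IsUnitCoboundary B σ (u j₁ ^ N j / u j) := by
  have hupz : ∀ j, IsUnitCoboundary B σ (u j ^ (p : ℤ)) := fun j => by rw [zpow_natCast]; exact hup j
  have main : ∀ j, ∃ n : ℤ, IsUnitCoboundary B σ (u j₁ ^ n / u j) := by
    intro j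
    obtain ⟨a, b, hab, hc⟩ := hdep j
    by_cases hb : (p : ℤ) ∣ b
    · exfalso
      have ha : ¬ (p : ℤ) ∣ a := fun ha => hab ⟨ha, hb⟩
      obtain ⟨m, hm⟩ := hb
      have h1 : IsUnitCoboundary B σ (u j ^ b) := by rw [hm, zpow_mul]; exact (hupz j).zpow m
      have h2 : IsUnitCoboundary B σ (u j₁ ^ a) := by
        have h := hc.mul h1.inv
        rwa [mul_inv_cancel_right₀ (zpow_ne_zero b (hu0 j))] at h
      exact hj₁ (isUnitCoboundary_of_zpow hp (hu0 j₁) (hup j₁) ha h2)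
    · obtain ⟨s, t, hst⟩ := (Prime.coprime_iff_not_dvd (Nat.prime_iff_prime_int.mp hp)).mpr hb
      have key : (u j ^ (p : ℤ)) ^ s * (u j₁ ^ a * u j ^ b) ^ t = u j * u j₁ ^ (a * t) := by
        rw [mul_zpow, ← zpow_mul, ← zpow_mul, ← zpow_mul, mul_left_comm, ← zpow_add₀ (hu0 j),
          show (p : ℤ) * s + b * t = 1 by linarith, zpow_one, mul_comm]
      have hL : IsUnitCoboundary B σ (u j * u j₁ ^ (a * t)) := by
        rw [← key]; exact ((hupz j).zpow s).mul (hc.zpow t)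
      refine ⟨-(a * t), ?_⟩
      have h := hL.inv
      rw [mul_inv, ← zpow_neg, mul_comm, ← div_eq_mul_inv] at h
      exact h
  choose N hN using main
  exact ⟨N, hN⟩

end Norm

/-! ## Principal units from norm one (residues in the fixed constants) -/
section Principal

variable (O : ValuationSubring E) {σ : E ≃+* E}

/-- `v(∏_{i<n} σⁱu − cⁿ) < 1` when `v(u − c) < 1`, `u ∈ O`, `c ∈ O` fixed by `σ` (induction:
`P_{n+1} − c^{n+1} = P_n (σⁿu − c) + c (P_n − cⁿ)`). [folklore] -/
theorem valuation_prod_pow_apply_sub_pow_lt (hσO : ∀ z : E, z ∈ O ↔ σ z ∈ O) {u c : E} (huO : u ∈ O)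
    (hcO : c ∈ O) (hσc : σ c = c) (huc : O.valuation (u - c) < 1) (n : ℕ) :
    O.valuation (∏ i ∈ Finset.range n, (σ ^ i) u - c ^ n) < 1 := by
  have hσic : ∀ i : ℕ, (σ ^ i) c = c := fun i => by
    induction i with
    | zero => rw [pow_zero, RingAut.one_apply]
    | succ i ih => rw [pow_succ', RingAut.mul_apply, ih, hσc]
  have hPO : ∀ n : ℕ, O.valuation (∏ i ∈ Finset.range n, (σ ^ i) u) ≤ 1 := fun n => by
    rw [map_prod]
    exact Finset.prod_le_one' fun i _ =>
      (O.valuation_le_one_iff _).mpr (pow_apply_mem (B := O.toSubring) (fun z hz => (hσO z).mp hz) i huO)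
  induction n with
  | zero => rw [Finset.prod_range_zero, pow_zero, sub_self, map_zero]; exact zero_lt_one
  | succ n ih =>
    have e : ∏ i ∈ Finset.range (n + 1), (σ ^ i) u - c ^ (n + 1) =
        (∏ i ∈ Finset.range n, (σ ^ i) u) * ((σ ^ n) u - c) + c * (∏ i ∈ Finset.range n, (σ ^ i) u - c ^ n) := by
      rw [Finset.prod_range_succ, pow_succ]; ring
    have h1 : O.valuation ((σ ^ n) u - c) < 1 := by
      rw [← hσic n, ← map_sub]; exact valuation_pow_apply_lt_one O hσO n huc
    rw [e]
    refine lt_of_le_of_lt (Valuation.map_add _ _ _) (max_lt ?_ ?_)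
    · rw [map_mul, mul_comm]; exact mul_lt_one_of_lt_of_le h1 (hPO n)
    · rw [map_mul, mul_comm]; exact mul_lt_one_of_lt_of_le ih ((O.valuation_le_one_iff _).mpr hcO)

/-- **PRINCIPAL UNITS FROM NORM ONE.**  A unit `u ∈ O` of norm `∏_{i<p} σⁱu = 1` whose residue lies in a
`σ`-fixed subfield `C ⊆ O` of constants is a PRINCIPAL unit: `v(u − 1) < 1` (its residue `c` has `c^p = 1`, and
Frobenius is injective).  [folklore] -/
theorem valuation_sub_one_lt_of_norm_eq_one (p : ℕ) [Fact p.Prime] [CharP E p]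
    (hσO : ∀ z : E, z ∈ O ↔ σ z ∈ O) (C : Subfield E) (hCO : ∀ c ∈ C, c ∈ O) (hCσ : ∀ c ∈ C, σ c = c)
    {u : E} (huO : u ∈ O) (hres : ∃ c ∈ C, O.valuation (u - c) < 1)
    (hnorm : ∏ i ∈ Finset.range p, (σ ^ i) u = 1) : O.valuation (u - 1) < 1 := by
  obtain ⟨c, hcC, huc⟩ := hres
  have h := valuation_prod_pow_apply_sub_pow_lt O hσO huO (hCO c hcC) (hCσ c hcC) huc p
  rw [hnorm] at h
  -- `1 − c^p` is a constant of value `< 1`, hence `0`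
  have hcp : c ^ p = 1 := by
    by_contra hne
    have hz : (1 - c ^ p) ≠ 0 := sub_ne_zero.mpr (Ne.symm hne)
    have hzC : (1 - c ^ p) ∈ C := C.sub_mem C.one_mem (C.pow_mem hcC p)
    have hv1 : O.valuation (1 - c ^ p) = 1 := by
      refine le_antisymm ((O.valuation_le_one_iff _).mpr (hCO _ hzC)) ?_
      have hinv : O.valuation (1 - c ^ p)⁻¹ ≤ 1 := (O.valuation_le_one_iff _).mpr (hCO _ (C.inv_mem hzC))
      rw [map_inv₀, inv_le_one₀ ((Valuation.pos_iff _).mpr hz)] at hinv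
      exact hinv
    exact (lt_irrefl (1 : _)) (hv1 ▸ h)
  have hc1 : c = 1 := by
    have e : (c - 1) ^ p = 0 := by rw [sub_pow_char, hcp, one_pow, sub_self]
    exact sub_eq_zero.mp (pow_eq_zero_iff (Fact.out : p.Prime).ne_zero |>.mp e)
  rw [hc1] at huc
  exact huc

end Principal

/-! ## Grade 0 is empty (Nakayama) -/
section GradeZero

variable (O : ValuationSubring E) {T : Subring E} {σ : E ≃+* E}

set_option maxHeartbeats 800000 in
/-- **GRADE 0 IS EMPTY (Nakayama).**  Let `B = T_𝔪′` (`T ⊆ O`, `σ` preserving `O` both ways and `T`) be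
Noetherian, `x₁ … x_d ∈ 𝔪_B` a generating system of the centre `{b ∈ B : v(b) < 1}`, and suppose every `b ∈ B`
is congruent mod the centre to a `σ`-FIXED element of `B` (residues in the constants).  If `σ` FIXES every `xᵢ`
then `σ = id` on `B`: the augmentation ideal `I = (σb − b : b ∈ B)` satisfies `I ⊆ 𝔪_B · I`
(`σb − b = Σ (σcᵢ − cᵢ) xᵢ` for `b ≡ c`, `b − c = Σ cᵢ xᵢ`), so `I = 0` by Nakayama.  Consequence for the
grading: a log-diagonal frame ALL of whose cocycles are unit coboundaries rescales to a fixed frame, which is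
impossible when a coordinate is moved. [folklore] -/
theorem apply_eq_self_of_apply_generators_eq (hTO : T ≤ O.toSubring) (hσO : ∀ z : E, z ∈ O ↔ σ z ∈ O)
    (hσT : ∀ z ∈ T, σ z ∈ T) [IsNoetherianRing (locAtCentre T O)]
    {d : ℕ} {x : Fin d → E} (hx : ∀ i, x i ∈ locAtCentre T O ∧ O.valuation (x i) < 1)
    (hgen : ∀ b ∈ locAtCentre T O, O.valuation b < 1 →
      ∃ c : Fin d → E, (∀ i, c i ∈ locAtCentre T O) ∧ b = ∑ i, c i * x i)
    (hres : ∀ b ∈ locAtCentre T O, ∃ c ∈ locAtCentre T O, σ c = c ∧ O.valuation (b - c) < 1)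
    (hfix : ∀ i, σ (x i) = x i) : ∀ b ∈ locAtCentre T O, σ b = b := by
  classical
  set B : Subring E := locAtCentre T O with hBdef
  haveI : IsLocalRing B := isLocalRing_locAtCentre hTO
  have hσB : ∀ z ∈ B, σ z ∈ B := fun z hz => apply_mem_locAtCentre O hσO hσT hz
  -- the augmentation map and ideal
  let δ : B → B := fun b => ⟨σ b - b, B.sub_mem (hσB _ b.2) b.2⟩
  let I : Ideal B := Ideal.span (Set.range δ)
  have hδI : ∀ b : B, δ b ∈ I := fun b => Ideal.subset_span ⟨b, rfl⟩
  -- `I ≤ 𝔪 • I`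
  have hxm : ∀ i, (⟨x i, (hx i).1⟩ : B) ∈ maximalIdeal B := fun i =>
    (mem_maximalIdeal_locAtCentre_iff hTO _).mpr (hx i).2
  have hstep : ∀ b : B, δ b ∈ maximalIdeal B • I := by
    intro b
    obtain ⟨c, hcB, hσc, hbc⟩ := hres b b.2
    obtain ⟨cf, hcf, hsum⟩ := hgen (b - c) (B.sub_mem b.2 hcB) hbc
    have e : δ b = ∑ i, (⟨x i, (hx i).1⟩ : B) * δ ⟨cf i, hcf i⟩ := by
      apply Subtype.ext
      rw [AddSubmonoidClass.coe_finsetSum]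
      change σ (b : E) - b = ∑ i, x i * (σ (cf i) - cf i)
      have hb : (b : E) = c + ∑ i, cf i * x i := by rw [← hsum]; ring
      rw [hb, map_add, hσc, map_sum]
      simp only [map_mul, hfix]
      rw [add_sub_add_left_eq_sub, ← Finset.sum_sub_distrib]
      exact Finset.sum_congr rfl fun i _ => by ring
    rw [e, Ideal.smul_eq_mul]
    exact Ideal.sum_mem _ fun i _ => Ideal.mul_mem_mul (hxm i) (hδI _)
  have hle : I ≤ maximalIdeal B • I := Ideal.span_le.mpr (by rintro _ ⟨b, rfl⟩; exact hstep b)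
  have hI : I = ⊥ := Submodule.eq_bot_of_le_smul_of_le_jacobson_bot (maximalIdeal B) I
    (IsNoetherian.noetherian I) hle (by rw [jacobson_eq_maximalIdeal ⊥ bot_ne_top])
  intro b hb
  have h0 : δ ⟨b, hb⟩ = 0 := by
    have h := hδI ⟨b, hb⟩
    rwa [hI, Ideal.mem_bot] at h
  have h1 : σ b - b = 0 := congrArg Subtype.val h0
  exact sub_eq_zero.mp h1

end GradeZero

end Summit.ResolutionOfSingularities.ResolutionOfSingularities.Theorems.WildCocycleLU

end
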